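import Mathlib
import Summits.PneNP.PneNP.Theorems.SymmetryBudgetHamCompilesStubRrefEchelon

/-!
# Stub `stub_rref` of line `kotzig-cutspan` (crux `SymmetryBudget.HamCompiles`, stmt-PneNP-10637)

Route `PneNP/SymmetryBudget`, crux `Summit.PneNP.PneNP.Theses.SymmetryBudget.HamCompiles`,
line `kotzig-cutspan`, registered stub `stub_rref` (three clauses about the F-side bookkeeping):

1. the rows of the choice-free reduced echelon table `rrefRow W` span `W`
   (`span_range_rrefRow`, file `SymmetryBudgetHamCompilesStubRrefEchelon.lean`);
2. `insertRow (rrefRow U) v = rrefRow (U ⊔ span {v})`: the fixed two-layer insertion map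
   computes the table of the enlarged subspace (`rrefRow_sup_span` below, via the pivot
   description `isPivot_sup_span_iff` and the characterisation `rrefRow_eq_of`);
3. the stars-and-bars code `sbCode` is injective on margin vectors `d : Fin g → ℕ` with
   `∑ d ≤ 2g` (`sbCode_injOn`: bar `i` sits at position `i + d₀ + ⋯ + dᵢ < 3g`, the positions
   are strictly increasing, equal codes give equal position sets, hence equal position maps by
   `Finset.orderEmbOfFin_unique`, hence equal `d` by peeling prefix sums).
-/

-- `Summit.PneNP.PneNP.…` duplicates `PneNP` BY DESIGN (single-problem summit, D-0017).
set_option linter.dupNamespace false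

noncomputable section

namespace Summit.PneNP.PneNP.Theorems.HamCompilesKC

open Finset

section Insert

variable {g : ℕ}

/-! ### Inserting a vector: the table of `U ⊔ span {v}` -/

/-- **Pivots after inserting a reduced vector.** If `v ≠ 0` vanishes at every pivot of `U`, the
pivots of `U ⊔ span {v}` are the pivots of `U` together with the leading coordinate of `v`. -/
theorem isPivot_sup_span_iff {U : Submodule (ZMod 2) (Vec g)} {v : Vec g} (hv : v ≠ 0)
    (hvU : ∀ p, IsPivot U p → v p = 0) (c : Fin g → Bool) :
    IsPivot (U ⊔ Submodule.span (ZMod 2) {v}) c ↔ IsPivot U c ∨ c = lead v := by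
  obtain ⟨hvl, hvlt⟩ := lead_spec hv
  constructor
  · rintro ⟨w, hw, hwc, hwlt⟩
    obtain ⟨u, hu, z, hz, rfl⟩ := Submodule.mem_sup.1 hw
    obtain ⟨a, rfl⟩ := Submodule.mem_span_singleton.1 hz
    have hwc' : (u + a • v) c ≠ 0 := by
      rw [hwc]
      exact one_ne_zero
    rcases zmod2_eq_zero_or_one a with ha | ha
    · subst ha
      left
      refine ⟨u, hu, ?_, ?_⟩
      · simpa using hwc
      · intro c' hc'
        simpa using hwlt c' hc'
    · subst ha
      rw [one_smul] at hwc' hwlt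
      by_cases hu0 : u = 0
      · subst hu0
        right
        rw [zero_add] at hwc' hwlt
        exact eq_of_leads hwc' hwlt hvl hvlt
      · obtain ⟨hul, hult⟩ := lead_spec hu0
        have hm : IsPivot U (lead u) := isPivot_lead hu hu0
        have hvm : v (lead u) = 0 := hvU _ hm
        have hne : skey (lead u) ≠ skey (lead v) := fun h => by
          rw [skey_injective h] at hvm
          exact hvl hvm
        rcases lt_or_gt_of_ne hne with hlt | hgt
        · left
          have hcu : c = lead u :=
            eq_of_leads hwc' hwlt (by simp [hvm, hul])
              (fun c' hc' => by simp [hult c' hc', hvlt c' (hc'.trans hlt)])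
          rw [hcu]
          exact hm
        · right
          exact eq_of_leads hwc' hwlt (by simp [hult _ hgt, hvl])
            (fun c' hc' => by simp [hvlt c' hc', hult c' (hc'.trans hgt)])
  · rintro (hc | rfl)
    · exact isPivot_mono le_sup_left hc
    · exact ⟨v, Submodule.mem_sup_right (Submodule.mem_span_singleton_self v),
        (zmod2_ne_zero_iff _).1 hvl, hvlt⟩

/-- Inserting `v` or its reduction `reduceBy (rrefRow U) v` spans the same subspace over `U`. -/
theorem sup_span_eq_sup_span_reduceBy (U : Submodule (ZMod 2) (Vec g)) (v : Vec g) :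
    U ⊔ Submodule.span (ZMod 2) {v} = U ⊔ Submodule.span (ZMod 2) {reduceBy (rrefRow U) v} := by
  have hs := sum_smul_rrefRow_mem U v
  apply le_antisymm
  · refine sup_le le_sup_left ((Submodule.span_singleton_le_iff_mem _ _).2 ?_)
    have hv : reduceBy (rrefRow U) v - ∑ c, v c • rrefRow U c ∈
        U ⊔ Submodule.span (ZMod 2) {reduceBy (rrefRow U) v} :=
      Submodule.sub_mem _
        (Submodule.mem_sup_right (Submodule.mem_span_singleton_self _))
        (Submodule.mem_sup_left hs)
    rwa [show reduceBy (rrefRow U) v - ∑ c, v c • rrefRow U c = v from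
      add_sub_cancel_right v _] at hv
  · refine sup_le le_sup_left ((Submodule.span_singleton_le_iff_mem _ _).2 ?_)
    exact Submodule.add_mem _ (Submodule.mem_sup_right (Submodule.mem_span_singleton_self _))
      (Submodule.mem_sup_left hs)

/-- **Clause 2 of `stub_rref`: `insertRow` computes the table of `U ⊔ span {v}` from the table
of `U`.** -/
theorem rrefRow_sup_span (U : Submodule (ZMod 2) (Vec g)) (v : Vec g) :
    rrefRow (U ⊔ Submodule.span (ZMod 2) {v}) = insertRow (rrefRow U) v := by
  obtain ⟨v', hv'⟩ : ∃ v', v' = reduceBy (rrefRow U) v := ⟨_, rfl⟩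
  have hv'U : ∀ p, IsPivot U p → v' p = 0 := fun p hp =>
    hv' ▸ reduceBy_rrefRow_apply_pivot v hp
  unfold insertRow
  rw [sup_span_eq_sup_span_reduceBy, ← hv']
  by_cases h0 : v' = 0
  · -- nothing is inserted: `v ∈ U`
    rw [if_pos h0, h0]
    -- `U ⊔ span {0} = U`
    rw [show U ⊔ Submodule.span (ZMod 2) {(0 : Vec g)} = U by simp]
  · rw [if_neg h0]
    obtain ⟨hvl, hvlt⟩ := lead_spec h0
    have hv'1 : v' (lead v') = 1 := (zmod2_ne_zero_iff _).1 hvl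
    have hmem : v' ∈ U ⊔ Submodule.span (ZMod 2) {v'} :=
      Submodule.mem_sup_right (Submodule.mem_span_singleton_self _)
    symm
    apply rrefRow_eq_of
    · intro c hc
      rw [isPivot_sup_span_iff h0 hv'U] at hc
      by_cases hcl : c = lead v'
      · subst hcl
        rw [if_pos rfl]
        refine ⟨hmem, hv'1, hvlt, fun p hp hpc => ?_⟩
        rw [isPivot_sup_span_iff h0 hv'U] at hp
        exact hv'U p (hp.resolve_right hpc)
      · have hcU : IsPivot U c := hc.resolve_right hcl
        rw [if_neg hcl]
        refine ⟨?_, ?_, ?_, ?_⟩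
        · exact Submodule.add_mem _ (Submodule.mem_sup_left (rrefRow_mem U c))
            (Submodule.smul_mem _ _ hmem)
        · simp [rrefRow_apply_self hcU, hv'U c hcU]
        · intro c'' hc''
          have h1 : rrefRow U c c'' = 0 := rrefRow_apply_of_lt U hc''
          by_cases h2 : rrefRow U c (lead v') = 0
          · simp [h1, h2]
          · have h3 : skey c < skey (lead v') := by
              by_contra hle
              rcases (not_lt.1 hle).lt_or_eq with hlt | heq
              · exact h2 (rrefRow_apply_of_lt U hlt)
              · exact hcl (skey_injective heq).symm
            simp [h1, hvlt c'' (hc''.trans h3)]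
        · intro p hp hpc
          rw [isPivot_sup_span_iff h0 hv'U] at hp
          rcases hp with hp | rfl
          · simp [rrefRow_apply_pivot_ne c hp hpc, hv'U p hp]
          · simp only [Pi.add_apply, Pi.smul_apply, smul_eq_mul, hv'1, mul_one]
            exact zmod2_add_self _
    · intro c hc
      rw [isPivot_sup_span_iff h0 hv'U, not_or] at hc
      rw [if_neg hc.2, rrefRow_of_not_isPivot hc.1]
      simp

end Insert

section SBCode

variable {g : ℕ}

/-! ### The stars-and-bars code

Bar `i` of the word `sbCode d` sits at position `i + d₀ + ⋯ + dᵢ`; we keep this expression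
explicit (no auxiliary definition) and call it "the position of bar `i`" in the docstrings. -/

/-- Peeling the last term off a prefix sum. -/
theorem sum_filter_le_eq (d : Fin g → ℕ) (i : Fin g) :
    ∑ t ∈ univ.filter (fun t : Fin g => t ≤ i), d t =
      d i + ∑ t ∈ univ.filter (fun t : Fin g => t < i), d t := by
  have h : univ.filter (fun t : Fin g => t ≤ i) =
      insert i (univ.filter fun t : Fin g => t < i) := by
    ext t
    simp only [Finset.mem_filter, Finset.mem_univ, true_and, Finset.mem_insert]
    constructor
    · intro ht
      exact ht.lt_or_eq.symm
    · rintro (rfl | ht)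
      · exact le_rfl
      · exact ht.le
  rw [h, Finset.sum_insert (by simp)]

/-- Bar positions are strictly increasing. -/
theorem sbPos_strictMono (d : Fin g → ℕ) :
    StrictMono fun i : Fin g => (i : ℕ) + ∑ t ∈ univ.filter (fun t : Fin g => t ≤ i), d t := by
  intro i j hij
  have hsub : univ.filter (fun t : Fin g => t ≤ i) ⊆ univ.filter (fun t : Fin g => t ≤ j) := by
    intro t
    simp only [Finset.mem_filter, Finset.mem_univ, true_and]
    exact fun h => h.trans hij.le
  have hle := Finset.sum_le_sum_of_subset (f := d) hsub
  have hij' : (i : ℕ) < j := hij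
  dsimp only
  omega

/-- With `∑ d ≤ 2g` all bars lie below `3g`. -/
theorem sbPos_lt (d : Fin g → ℕ) (hd : ∑ t, d t ≤ 2 * g) (i : Fin g) :
    (i : ℕ) + ∑ t ∈ univ.filter (fun t : Fin g => t ≤ i), d t < 3 * g := by
  have hle : ∑ t ∈ univ.filter (fun t : Fin g => t ≤ i), d t ≤ ∑ t, d t :=
    Finset.sum_le_sum_of_subset (f := d) (Finset.filter_subset _ _)
  have hi := i.isLt
  omega

/-- Equal code words: every bar of `d` is a bar of `d'`. -/
theorem exists_sbPos_eq_of_sbCode_eq {d d' : Fin g → ℕ} (hd : ∑ t, d t ≤ 2 * g)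
    (h : sbCode d = sbCode d') (i : Fin g) :
    ∃ i' : Fin g, (i : ℕ) + ∑ t ∈ univ.filter (fun t : Fin g => t ≤ i), d t =
      (i' : ℕ) + ∑ t ∈ univ.filter (fun t : Fin g => t ≤ i'), d' t := by
  have hj := congrFun h ⟨_, sbPos_lt d hd i⟩
  unfold sbCode at hj
  rw [decide_eq_decide] at hj
  exact hj.1 ⟨i, rfl⟩

/-- Equal code words: equal sets of bars. -/
theorem image_sbPos_eq {d d' : Fin g → ℕ} (hd : ∑ t, d t ≤ 2 * g) (hd' : ∑ t, d' t ≤ 2 * g)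
    (h : sbCode d = sbCode d') :
    univ.image (fun i : Fin g => (i : ℕ) + ∑ t ∈ univ.filter (fun t : Fin g => t ≤ i), d t) =
      univ.image (fun i : Fin g => (i : ℕ) + ∑ t ∈ univ.filter (fun t : Fin g => t ≤ i), d' t) := by
  ext n
  simp only [Finset.mem_image, Finset.mem_univ, true_and]
  constructor
  · rintro ⟨i, rfl⟩
    obtain ⟨i', hi'⟩ := exists_sbPos_eq_of_sbCode_eq hd h i
    exact ⟨i', hi'.symm⟩
  · rintro ⟨i', rfl⟩
    obtain ⟨i, hi⟩ := exists_sbPos_eq_of_sbCode_eq hd' h.symm i'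
    exact ⟨i, hi.symm⟩

/-- Equal code words: equal bar positions (a strictly increasing enumeration of a finite set is
unique, `Finset.orderEmbOfFin_unique`). -/
theorem sbPos_eq_of_sbCode_eq {d d' : Fin g → ℕ} (hd : ∑ t, d t ≤ 2 * g)
    (hd' : ∑ t, d' t ≤ 2 * g) (h : sbCode d = sbCode d') :
    (fun i : Fin g => (i : ℕ) + ∑ t ∈ univ.filter (fun t : Fin g => t ≤ i), d t) =
      fun i : Fin g => (i : ℕ) + ∑ t ∈ univ.filter (fun t : Fin g => t ≤ i), d' t := by
  have hcard : (univ.image fun i : Fin g =>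
      (i : ℕ) + ∑ t ∈ univ.filter (fun t : Fin g => t ≤ i), d t).card = g := by
    rw [Finset.card_image_of_injective _ (sbPos_strictMono d).injective, Finset.card_univ,
      Fintype.card_fin]
  have himg := image_sbPos_eq hd hd' h
  have h1 := Finset.orderEmbOfFin_unique hcard
    (fun i => Finset.mem_image_of_mem _ (Finset.mem_univ i)) (sbPos_strictMono d)
  have h2 := Finset.orderEmbOfFin_unique hcard
    (fun i => himg ▸ Finset.mem_image_of_mem _ (Finset.mem_univ i)) (sbPos_strictMono d')
  exact h1.trans h2.symm

/-- **Clause 3 of `stub_rref`: the stars-and-bars code is injective on `{d | ∑ d ≤ 2g}`.** -/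
theorem sbCode_injOn {d d' : Fin g → ℕ} (hd : ∑ t, d t ≤ 2 * g) (hd' : ∑ t, d' t ≤ 2 * g)
    (h : sbCode d = sbCode d') : d = d' := by
  have hpos := sbPos_eq_of_sbCode_eq hd hd' h
  suffices H : ∀ n : ℕ, ∀ i : Fin g, (i : ℕ) = n → d i = d' i by
    funext i
    exact H i i rfl
  intro n
  induction n using Nat.strong_induction_on with
  | _ n ih =>
    intro i hi
    have hpi := congrFun hpos i
    simp only [sum_filter_le_eq] at hpi
    have hlt : ∑ t ∈ univ.filter (fun t : Fin g => t < i), d t =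
        ∑ t ∈ univ.filter (fun t : Fin g => t < i), d' t := by
      refine Finset.sum_congr rfl fun t ht => ?_
      simp only [Finset.mem_filter, Finset.mem_univ, true_and] at ht
      exact ih t (hi ▸ Fin.lt_def.1 ht) t rfl
    omega

end SBCode

/-- **Stub `stub_rref` of line `kotzig-cutspan`** (crux `SymmetryBudget.HamCompiles`): the rows of
the reduced echelon table span the subspace; `insertRow` computes the table of `U ⊔ span {v}`
from the table of `U`; the stars-and-bars code is injective on margins of total mass `≤ 2g`. -/
theorem stub_rref :
    (∀ (g : ℕ) (W : Submodule (ZMod 2) (Vec g)),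
        Submodule.span (ZMod 2) (Set.range (rrefRow W)) = W) ∧
    (∀ (g : ℕ) (U : Submodule (ZMod 2) (Vec g)) (v : Vec g),
        rrefRow (U ⊔ Submodule.span (ZMod 2) {v}) = insertRow (rrefRow U) v) ∧
    (∀ (g : ℕ) (d d' : Fin g → ℕ), (∑ t, d t) ≤ 2 * g → (∑ t, d' t) ≤ 2 * g →
        sbCode d = sbCode d' → d = d') :=
  ⟨fun _ W => span_range_rrefRow W, fun _ U v => rrefRow_sup_span U v,
    fun _ _ _ hd hd' h => sbCode_injOn hd hd' h⟩

end Summit.PneNP.PneNP.Theorems.HamCompilesKC
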